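import Mathlib
import Literature.NumberTheory.Transcendental.AnalytificationFunctorialityProofs
import Summits.NavierStokesRegularity.NavierStokesRegularity.Theses.BarrierStepRungThree
import HarnessLib

/-!
# Gradient evaluator for polynomial clocks (route `BarrierStepRungThree`, items
  stmt-NavierStokesRegularity-23942 / 23648)

The certificate items `PolynomialWindowCertificate` / `WindowCertificateMargin` of route
`BarrierStepRungThree` ask, for a clock/barrier `v : (Fin 4 → Fin n → ℝ) → ℝ` that is the evaluation
of a real multivariate polynomial `p` in the window coordinates
(`v x = MvPolynomial.eval (fun ij => x ij.1 ij.2) p`), two clauses about its Fréchet derivative: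
the (undisturbed) DECREASE clause `(fderiv ℝ v (win S)) w ≤ -2γ` and the operator-norm clause
`‖fderiv ℝ v x‖ ≤ Λ` on `{v ≤ 0}` (sup norm on `Fin 4 → Fin n → ℝ`).  This table-free file turns
both into explicit polynomial inequalities, which is the form a rational certificate is checked in:

* `hasStrictFDerivAt_eval_window`, `fderiv_eval_window_apply` — the derivative of `v` at `x`
  applied to a direction `d` is the gradient pairing `∑_ij (∂_ij p)(x) · d ij.1 ij.2`;
* `opNorm_fderiv_eval_window_le` — `‖fderiv ℝ v x‖ ≤ ∑_ij |(∂_ij p)(x)|` (the dual of the sup norm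
  is the ℓ¹ norm of the gradient);
* `fderiv_le_of_gradient_pairing_le`, `opNorm_fderiv_le_of_gradient_abs_sum_le` — the two clause
  reductions for a `v` given extensionally as such an evaluation;
* `abs_eval_le_sum_support` — `|q(x)| ≤ ∑_{s ∈ supp q} |coeff s q| · ∏ M^s` on the box `|x_ij| ≤ M_ij`,
  the bookkeeping that produces a numerical `Λ` from the properness clause `v ≤ 0 → |x_ij| ≤ M_ij`.

The derivative formula is the tree lemma
`Literature.NumberTheory.Transcendental.MvPolynomial.hasStrictFDerivAt_eval` (polynomial maps on
`ι → 𝕜`) composed with the continuous linear "uncurrying" map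
`(Fin 4 → Fin n → ℝ) →L[ℝ] (Fin 4 × Fin n → ℝ)`.

HONEST FRAMING: elementary calculus/bookkeeping for certificate CHECKING on a Tao-type MODEL lattice
line (rung TL-M3); it constructs no certificate and says nothing about the Navier–Stokes equations;
no summit is proved by this file.
-/

noncomputable section

-- the sub-problem namespace repeats the summit name by design (D-0017)
set_option linter.dupNamespace false

namespace Summit.NavierStokesRegularity.NavierStokesRegularity.Theorems

namespace PolynomialClock

open scoped BigOperators

variable {n : ℕ}

/-- The continuous linear "uncurrying" map `x ↦ (ij ↦ x ij.1 ij.2)` from the window space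
`Fin 4 → Fin n → ℝ` to `Fin 4 × Fin n → ℝ`, written with `ContinuousLinearMap.pi`/`proj` (no new
definition is introduced; this lemma records its action). [folklore] -/
theorem uncurryCLM_apply (x : Fin 4 → Fin n → ℝ) (ij : Fin 4 × Fin n) :
    (ContinuousLinearMap.pi fun ij : Fin 4 × Fin n =>
        (ContinuousLinearMap.proj (R := ℝ) (φ := fun _ : Fin n => ℝ) ij.2).comp
          (ContinuousLinearMap.proj (R := ℝ) (φ := fun _ : Fin 4 => Fin n → ℝ) ij.1)) x ij =
      x ij.1 ij.2 := rfl

/-- **Derivative of a polynomial clock.** For `p ∈ ℝ[X_ij : ij ∈ Fin 4 × Fin n]`, the function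
`x ↦ p(x)` on the window space `Fin 4 → Fin n → ℝ` has strict Fréchet derivative
`d ↦ ∑_ij (∂_ij p)(x) · d ij.1 ij.2` at every `x` (chain rule through the uncurrying map and
`MvPolynomial.hasStrictFDerivAt_eval`). [folklore] -/
theorem hasStrictFDerivAt_eval_window (p : MvPolynomial (Fin 4 × Fin n) ℝ)
    (x : Fin 4 → Fin n → ℝ) :
    HasStrictFDerivAt
      (fun y : Fin 4 → Fin n → ℝ => MvPolynomial.eval (fun ij : Fin 4 × Fin n => y ij.1 ij.2) p)
      ((∑ ij : Fin 4 × Fin n,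
          MvPolynomial.eval (fun ij : Fin 4 × Fin n => x ij.1 ij.2) (MvPolynomial.pderiv ij p) •
            ContinuousLinearMap.proj (R := ℝ) (φ := fun _ : Fin 4 × Fin n => ℝ) ij).comp
        (ContinuousLinearMap.pi fun ij : Fin 4 × Fin n =>
          (ContinuousLinearMap.proj (R := ℝ) (φ := fun _ : Fin n => ℝ) ij.2).comp
            (ContinuousLinearMap.proj (R := ℝ) (φ := fun _ : Fin 4 => Fin n → ℝ) ij.1)))
      x := by
  set U : (Fin 4 → Fin n → ℝ) →L[ℝ] (Fin 4 × Fin n → ℝ) :=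
    ContinuousLinearMap.pi fun ij : Fin 4 × Fin n =>
      (ContinuousLinearMap.proj (R := ℝ) (φ := fun _ : Fin n => ℝ) ij.2).comp
        (ContinuousLinearMap.proj (R := ℝ) (φ := fun _ : Fin 4 => Fin n → ℝ) ij.1) with hU
  have hUx : ∀ y : Fin 4 → Fin n → ℝ, U y = fun ij : Fin 4 × Fin n => y ij.1 ij.2 := fun y => rfl
  have h := (Literature.NumberTheory.Transcendental.MvPolynomial.hasStrictFDerivAt_eval p (U x)).comp
    x U.hasStrictFDerivAt
  simpa only [Function.comp_def, hUx] using h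

/-- **Gradient pairing formula**: `(fderiv ℝ v x) d = ∑_ij (∂_ij p)(x) · d ij.1 ij.2` for the
polynomial clock `v = p ∘ (window coordinates)`. [folklore] -/
theorem fderiv_eval_window_apply (p : MvPolynomial (Fin 4 × Fin n) ℝ)
    (x d : Fin 4 → Fin n → ℝ) :
    fderiv ℝ
        (fun y : Fin 4 → Fin n → ℝ => MvPolynomial.eval (fun ij : Fin 4 × Fin n => y ij.1 ij.2) p)
        x d =
      ∑ ij : Fin 4 × Fin n,
        MvPolynomial.eval (fun ij : Fin 4 × Fin n => x ij.1 ij.2) (MvPolynomial.pderiv ij p) *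
          d ij.1 ij.2 := by
  rw [(hasStrictFDerivAt_eval_window p x).hasFDerivAt.fderiv]
  simp only [ContinuousLinearMap.coe_comp, Function.comp_apply, FunLike.coe_sum,
    Finset.sum_apply, FunLike.coe_smul, Pi.smul_apply, ContinuousLinearMap.proj_apply,
    smul_eq_mul]
  rfl

/-- Polynomial clocks are differentiable. [folklore] -/
theorem differentiableAt_eval_window (p : MvPolynomial (Fin 4 × Fin n) ℝ)
    (x : Fin 4 → Fin n → ℝ) :
    DifferentiableAt ℝ
      (fun y : Fin 4 → Fin n → ℝ => MvPolynomial.eval (fun ij : Fin 4 × Fin n => y ij.1 ij.2) p)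
      x :=
  (hasStrictFDerivAt_eval_window p x).hasFDerivAt.differentiableAt

/-- Each window coordinate is bounded by the sup norm: `|d i j| ≤ ‖d‖`. [folklore] -/
theorem abs_apply_apply_le_norm (d : Fin 4 → Fin n → ℝ) (i : Fin 4) (j : Fin n) :
    |d i j| ≤ ‖d‖ :=
  (Real.norm_eq_abs _).symm.le.trans ((norm_le_pi_norm (d i) j).trans (norm_le_pi_norm d i))

/-- **Operator norm of the derivative of a polynomial clock** (sup norm on the window space, so the
dual norm is the ℓ¹ norm of the gradient): `‖fderiv ℝ v x‖ ≤ ∑_ij |(∂_ij p)(x)|`. [folklore] -/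
theorem opNorm_fderiv_eval_window_le (p : MvPolynomial (Fin 4 × Fin n) ℝ)
    (x : Fin 4 → Fin n → ℝ) :
    ‖fderiv ℝ
        (fun y : Fin 4 → Fin n → ℝ => MvPolynomial.eval (fun ij : Fin 4 × Fin n => y ij.1 ij.2) p)
        x‖ ≤
      ∑ ij : Fin 4 × Fin n,
        |MvPolynomial.eval (fun ij : Fin 4 × Fin n => x ij.1 ij.2) (MvPolynomial.pderiv ij p)| := by
  refine ContinuousLinearMap.opNorm_le_bound _ (Finset.sum_nonneg fun ij _ => abs_nonneg _)
    fun d => ?_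
  rw [fderiv_eval_window_apply, Real.norm_eq_abs, Finset.sum_mul]
  refine (Finset.abs_sum_le_sum_abs _ _).trans (Finset.sum_le_sum fun ij _ => ?_)
  rw [abs_mul]
  exact mul_le_mul_of_nonneg_left (abs_apply_apply_le_norm d ij.1 ij.2) (abs_nonneg _)

/-- **Decrease-clause reduction.** If `v` is (extensionally) the polynomial clock of `p`, then the
clause `(fderiv ℝ v x) w ≤ b` follows from the polynomial inequality
`∑_ij (∂_ij p)(x) · w ij.1 ij.2 ≤ b`. [folklore] -/
theorem fderiv_le_of_gradient_pairing_le (p : MvPolynomial (Fin 4 × Fin n) ℝ)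
    (v : (Fin 4 → Fin n → ℝ) → ℝ)
    (hv : ∀ x, v x = MvPolynomial.eval (fun ij : Fin 4 × Fin n => x ij.1 ij.2) p)
    (x w : Fin 4 → Fin n → ℝ) (b : ℝ)
    (h : ∑ ij : Fin 4 × Fin n,
        MvPolynomial.eval (fun ij : Fin 4 × Fin n => x ij.1 ij.2) (MvPolynomial.pderiv ij p) *
          w ij.1 ij.2 ≤ b) :
    (fderiv ℝ v x) w ≤ b := by
  have e : v = fun y => MvPolynomial.eval (fun ij : Fin 4 × Fin n => y ij.1 ij.2) p := funext hv
  rw [e, fderiv_eval_window_apply]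
  exact h

/-- **Decrease-clause evaluation** (equality form): `(fderiv ℝ v x) w` IS the gradient pairing.
[folklore] -/
theorem fderiv_apply_eq_gradient_pairing (p : MvPolynomial (Fin 4 × Fin n) ℝ)
    (v : (Fin 4 → Fin n → ℝ) → ℝ)
    (hv : ∀ x, v x = MvPolynomial.eval (fun ij : Fin 4 × Fin n => x ij.1 ij.2) p)
    (x w : Fin 4 → Fin n → ℝ) :
    (fderiv ℝ v x) w =
      ∑ ij : Fin 4 × Fin n,
        MvPolynomial.eval (fun ij : Fin 4 × Fin n => x ij.1 ij.2) (MvPolynomial.pderiv ij p) *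
          w ij.1 ij.2 := by
  have e : v = fun y => MvPolynomial.eval (fun ij : Fin 4 × Fin n => y ij.1 ij.2) p := funext hv
  rw [e, fderiv_eval_window_apply]

/-- **Λ-clause reduction.** If `v` is the polynomial clock of `p`, the operator-norm clause
`‖fderiv ℝ v x‖ ≤ Λ` follows from the gradient bound `∑_ij |(∂_ij p)(x)| ≤ Λ`. [folklore] -/
theorem opNorm_fderiv_le_of_gradient_abs_sum_le (p : MvPolynomial (Fin 4 × Fin n) ℝ)
    (v : (Fin 4 → Fin n → ℝ) → ℝ)
    (hv : ∀ x, v x = MvPolynomial.eval (fun ij : Fin 4 × Fin n => x ij.1 ij.2) p)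
    (x : Fin 4 → Fin n → ℝ) (Λ : ℝ)
    (h : ∑ ij : Fin 4 × Fin n,
        |MvPolynomial.eval (fun ij : Fin 4 × Fin n => x ij.1 ij.2) (MvPolynomial.pderiv ij p)| ≤ Λ) :
    ‖fderiv ℝ v x‖ ≤ Λ := by
  have e : v = fun y => MvPolynomial.eval (fun ij : Fin 4 × Fin n => y ij.1 ij.2) p := funext hv
  rw [e]
  exact (opNorm_fderiv_eval_window_le p x).trans h

/-- **Box bound for a polynomial value.** On the box `|x_i| ≤ M_i` one has
`|q(x)| ≤ ∑_{s ∈ supp q} |coeff s q| · ∏_{i ∈ supp s} M_i ^ s_i` — the coefficient-wise bound that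
turns the properness clause `v ≤ 0 → |x_ij| ≤ M_ij` into a numerical gradient bound `Λ`.
[folklore] -/
theorem abs_eval_le_sum_support {σ : Type*} (q : MvPolynomial σ ℝ) (x M : σ → ℝ)
    (hx : ∀ i, |x i| ≤ M i) :
    |MvPolynomial.eval x q| ≤
      ∑ s ∈ q.support, |MvPolynomial.coeff s q| * ∏ i ∈ s.support, M i ^ s i := by
  rw [MvPolynomial.eval_eq]
  refine (Finset.abs_sum_le_sum_abs _ _).trans (Finset.sum_le_sum fun s _ => ?_)
  rw [abs_mul, Finset.abs_prod]
  refine mul_le_mul_of_nonneg_left (Finset.prod_le_prod (fun i _ => abs_nonneg _) fun i _ => ?_)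
    (abs_nonneg _)
  rw [abs_pow]
  exact pow_le_pow_left₀ (abs_nonneg _) (hx i) _

end PolynomialClock

end Summit.NavierStokesRegularity.NavierStokesRegularity.Theorems

end
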